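import Literature.NumberTheory.EllipticCurves.ManinConstantQuadraticTwistAtTwoOrdinaryProofs
import HarnessLib
import HarnessLib.Audit.Tags

/-!
# Candidate E-an-1 of cell `bsd-f2-manin` (D-0131 (3) frontier: the Manin constant at additive
# primes): Stevens' case `η = 2` at `p = 2` on `Γ₀` — «`2 ∤ c₀(𝒜)` for `𝒜 = 𝒜′ ⊗ ℚ(√±2)` with `𝒜′`
# GOOD SUPERSINGULAR at `2`». A `@[conjecture]` leaf (NOTHING asserted; definition only; proved
# placement edges in the sibling `TwoNotDvdManinOfTwistAtTwoEdges.lean`).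

HONEST FRAMING. LENS = analytic / period lattices (planner `bsd-f2-manin-an`, HOME
`run/shared/lean/pub/bsd-f2-manin/MEMO-an.md` §§2–4, HOME/an/Sketch-an.lean sha16 1b7dcf4617dbd0dd,
farm rc 0). Informal law: for the `X₀(N)`-optimal curve `E` of a class `𝒜 = 𝒜′ ⊗ χ_{±8}` whose
partner `𝒜′` has GOOD SUPERSINGULAR reduction at `2` (`a₂` even; Stevens' `η = 2`), `2 ∤ c_E`. The
tree PROVES every `η = 1` case (`Literature.NumberTheory.EllipticCurves.ModularForms.`
`not_dvd_maninConstant_of_isTwistOfSemistableAtTwo_etaOne_gamma0`: `d = −1`, or `2 ∣ N(𝒜′)`, or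
`a₂(𝒜′)` odd); the case `η = 2` is the one Stevens 1989 Lemma (5.4) / Edixhoven 1991 §1 exclude
(`χ` ramified at `2` with `8 ∣ cond χ` and `𝒜′` supersingular at `2`) — NOT in print (refuter-2
placement pending; memo §7). Proposed mechanism (memo §4): K1 `EtaTwoTwistPeriodLattice`
(`g(χ)·Λ(f_χ) ⊆ 2·Λ(f)` for `χ = χ_{±8}`, `a₂` even — the new lemma), S1 (Hecke `T₂` on modular
symbols), K2 (the twist equation `W′.quadraticTwist (±2)` is globally minimal, Kodaira II at `2`),
G1 (the scaled twist step). BC5 WITNESS: HOME/an/twistlattice-rows.tsv.gz sha16 8048591e49d09b2f,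
filter `eta = 2`: meets 7 042 classes (levels `64·M ≤ 499 968`); beyond-print = ALL of them
(Česnavičius 2018 void at `64 ∣ N`; ČNS void on Kodaira II, `f₂ = 6` — `2 ∣ deg φ₀`; Edixhoven void
at `p = 2`); violations 0 (`c_E ≡ 1` in range — refuter-1 T4). «Why novel»: one sentence above.
Beyond-print theorem candidate: YES (memo §4 gives a complete paper proof sketch through tree
lemmas). Refuter verdicts: REF1 **SURVIVES** 2026-08-27T14:02Z (HOME/REFUTER-ref1.md
§R1.9: theorem candidate; Sketch-an verbatim rc 0, 6 crux probes CLEAN; proof chain K1 + S1 + K2 + G1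
audited on paper); REF2 pending at filing.

RENDERING: VERBATIM the planner's `ManinAnalyticLensSketch.TwoNotDvdManinOfTwistEtaTwo` — the
displayed binders of the landed `η = 1` theorem with its `hη` replaced by
`(hd : d = 2 ∨ d = −2) (hgood : W′.HasGoodReductionAtPrime 2) (hss : Even (W′.LFunction 2))` and
`h4N′` dropped (implied by `hgood`). The four leading binders are the by-name Manin facts the landed
theorem also carries (Mazur / Abbes–Ullmo / Česnavičius at `2` / modularity `exists_isNewformOf`),
so the law is stated MODULO them exactly as its `η = 1` sibling; `W₀` ranges over the globally
minimal members of the class with a lattice-optimal datum `D₀` (refuter-1 traps T1/T2 satisfied;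
`N₀` free = T3-harmless, no `v₂(N₀)` is read).
-/

noncomputable section

open scoped MatrixGroups ModularForm

open CongruenceSubgroup WeierstrassCurve
  Literature.NumberTheory.EllipticCurves Literature.NumberTheory.EllipticCurves.ModularForms

namespace Summit.BirchSwinnertonDyer.Rank1Residual.ManinAdditive

/-- **Candidate E-an-1 `TwoNotDvdManinOfTwistEtaTwo` (cell bsd-f2-manin; OPEN, NOT in print,
nothing asserted):** modulo the by-name Manin facts `hM hAU hC2 hnf`, for elliptic `W ~ W′ ⊗ χ_d`
with `d ∈ {2, −2}`, `W′` globally minimal, GOOD at `2` with `a₂(W′)` even (supersingular),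
`N(W′) ∣ N(W)`, `(4|d|)² = 64 ∣ N(W)`, `W` additive at `2`: every lattice-optimal datum `D₀` of every
globally minimal `W₀ ~ W` has `2 ∤ D₀.maninConstant` — Stevens' case `η = 2` on `Γ₀`, the complement
of the tree theorem `not_dvd_maninConstant_of_isTwistOfSemistableAtTwo_etaOne_gamma0`.
[cite: Stevens1989, Lemma (5.4) and §5 (shape only: the printed twist comparison excludes η = 2; the law is NOT in print — cell bsd-f2-manin MEMO-an.md §3)] -/
@[conjecture] def TwoNotDvdManinOfTwistEtaTwo : Prop :=
  ∀ (_hM : mazur_not_dvd_maninConstant_of_odd)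
    (_hAU : abbesUllmo_not_dvd_maninConstant_of_not_dvd_level)
    (_hC2 : cesnavicius_not_two_dvd_maninConstant_of_two_dvd_level) (_hnf : exists_isNewformOf)
    {W : WeierstrassCurve ℚ} [W.IsElliptic] {W' : WeierstrassCurve ℚ} [W'.IsElliptic]
    [W'.IsGloballyMinimal] {d : ℤ} (_hd : d = 2 ∨ d = -2)
    (_htw : IsIsogenous W (W'.quadraticTwist (d : ℚ)))
    (_hN'N : W'.conductorNorm ℤ ∣ W.conductorNorm ℤ)
    (_hmN : (4 * d.natAbs) ^ 2 ∣ W.conductorNorm ℤ)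
    (_hgood : W'.HasGoodReductionAtPrime 2) (_hss : Even (W'.LFunction 2))
    (_hadd : ¬ W.HasGoodReductionAtPrime 2 ∧ ¬ W.HasMultiplicativeReductionAtPrime 2)
    (W₀ : WeierstrassCurve ℚ) [W₀.IsElliptic] [W₀.IsGloballyMinimal] {N₀ : ℕ} [NeZero N₀]
    (D₀ : ModularParametrizationData W₀ N₀) (_hiso : IsIsogenous W W₀)
    (_h₀ : ∀ z ∈ D₀.L.lattice, ∃ w ∈ periodLattice D₀.f, z = D₀.c * w),
    ¬ (2 : ℤ) ∣ D₀.maninConstant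

end Summit.BirchSwinnertonDyer.Rank1Residual.ManinAdditive

end
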